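/-
Copyright (c) 2026 the pub-hodgecm-mathlib formalisation cell (harness21).  Prover seat hodgecm-mathlib-K2E1-p12 (g0), Track B ∕ K2-LIT (build stream 29),
h413 = `stmt-HodgeConjecture-24833`, line `K2_E1_TraceFormulaBeta`, 5Res campaign, rung R8₂-sph «EXHAUSTION» (ROADCARD `K2/K2E1-p09/g6/ROADCARD-R8-EXHAUSTION-SPH-2.K2E1-p09-g6.md`,
ROAD T′, step T7), dealer K2E1-plan (g6) deal (80) 2026-09-04T10:34:42Z: THE LEVEL SETS OF THE SPHERICAL TRANSFORM `t ↦ ĥ(σ + it)` ARE COUNTABLE (so T6's «null level sets»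
hypothesis is met by ONE test function), every rank.
-/
import Summits.HodgeConjecture.HodgeConjecture.Theorems.K2E1SphericalHeckeEigenSectionU2                -- ★ (a) `differentiable_integral_mul_borelHeight_cpow` (the spherical transform `ĥ` is entire, every rank)
import Summits.HodgeConjecture.HodgeConjecture.Theorems.K2E1BLUniquenessU2                              -- ★ `tendsto_integral_mul_borelHeight_rpow_atTop` (`ĥ(σ) → +∞`, every rank)
import Summits.HodgeConjecture.HodgeConjecture.Theorems.K2E1ProjectionCommutingMultiplicationOperators  -- ★ T6 (this seat, p859424): null level sets ⇒ no eigenvectors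
import Mathlib.Analysis.Complex.CauchyIntegral
import Mathlib.Analysis.Analytic.IsolatedZeros
import Mathlib.Topology.DiscreteSubset
import HarnessLib

/-!
# K2·E1 — `K2E1SphericalTransformLevelSetsCountableU` (R8₂-sph, ROAD T′, step T7, EVERY RANK): THE LEVEL SETS OF A NON-CONSTANT ENTIRE FUNCTION ARE COUNTABLE; THE SPHERICAL TRANSFORM
# `ĥ(z) = ∫ h(x)·H(x)^z dμ` IS ENTIRE AND, FOR `h ≥ 0` CHARGING A POINT OF HEIGHT `> 1`, NON-CONSTANT — SO `t ↦ ĥ(σ + it)` HAS COUNTABLE (HENCE DIFFUSE-NULL) LEVEL SETS AND THE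
# MULTIPLICATION OPERATOR `M_{ĥ(σ + i·)}` HAS NO EIGENVECTORS

Track B ∕ K2-LIT, crux h413 = `stmt-HodgeConjecture-24833`, route of record `HCCMUnconditional`; cell `hodgecm-mathlib`, squad K2, ENGINE E1.  THEOREMS ONLY (no `def`, no `instance`, no
notation, no named-fact hypothesis, no `sorry`; default heartbeats); lane `--kind proof --supports stmt-HodgeConjecture-24833 --as helper` (count-neutral).  ROADCARD T7 asked for «point
separation by `t ↦ ĥ(½+it)` over the ★ P5c family»; ★ T6 (this seat, `K2E1ProjectionCommutingMultiplicationOperators`) showed that ONE multiplier with NULL LEVEL SETS suffices, and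
this file supplies it: no family, no Stone–Weierstrass.

THE MATHEMATICS [Iwaniec2002, §7 (p. 103); Borel1997, §13; MoeglinWaldspurger1995, II.1.2; Langlands1976, §6].  (§1, Mathlib only) For `g` analytic on a neighbourhood of ℂ (= entire)
and `c` with `g ≢ c`, the identity principle (`AnalyticOnNhd.eqOn_or_eventually_ne_of_preconnected` on the preconnected `univ`) makes `{g ≠ c}` CODISCRETE in ℂ; a set with codiscrete
complement meets every compact ball in a finite set (`IsCompact.finite_sdiff_of_mem_codiscreteWithin`), so `{g = c} = ⋃ₙ ({g = c} ∩ B̄(0, n))` is COUNTABLE, and so is its trace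
`{t : ℝ | g(σ + it) = c}` on every vertical line (injective parametrisation).  (§2) The spherical transform `ĥ(z) = ∫ h(x) H(x)^z dμ` of a compactly supported continuous `h` is ENTIRE
(★ `differentiable_integral_mul_borelHeight_cpow`), so for every `σ, c` either `ĥ ≡ c` or `{t | ĥ(σ + it) = c}` is countable; (§3) for `h ≥ 0` real, not vanishing at some `g₀` with
`H(g₀) > 1`, and `μ` positive on open sets, `ĥ(σ) → +∞` along the reals (★ `tendsto_integral_mul_borelHeight_rpow_atTop`), so `ĥ` is NOT constant and ALL line level sets are countable,
hence null for every measure without atoms; (§4) with ★ T6: an a.e. eigenfunction of `M_{ĥ(σ + i·)}` on `(ℝ, ν)`, `ν` diffuse, vanishes a.e.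

* §1 (Mathlib only) **`countable_setOf_eq_of_analyticOnNhd_univ`**, **`countable_setOf_eq_of_differentiable`**, **`countable_setOf_line_eq_of_differentiable`** (`{t | g(σ + t·I) = c}`).
* §2 (every rank) **`countable_setOf_sphericalTransform_line_eq_of_exists_ne`** (on the letter `∃ z, ĥ z ≠ c`).
* §3 (every rank) `integral_mul_borelHeight_cpow_ofReal` (`ĥ(σ) = ↑(real transform)`), **`exists_sphericalTransform_ne`** (non-constancy, letter-free for `h ≥ 0` charging `{H > 1}`),
  **`countable_setOf_sphericalTransform_line_eq`**, **`measure_setOf_sphericalTransform_line_eq`** (`= 0` for `[NullSingletonClass ν]`).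
* §4 (every rank, with ★ T6) **`ae_eq_zero_of_ae_sphericalTransform_smul_eq_smul`**: `(∀ᵐ t ∂ν, ĥ(σ + it)·f t = c·f t) → f =ᵐ[ν] 0`.
HONEST LABEL: HC_CM is proved only modulo the 7 printed citations (2 remaining named inputs: hLiu418 = `stmt-HodgeConjecture-24832`, h413 = `stmt-HodgeConjecture-24833`) until rung 0
closes; this file asserts no named fact, closes no socket and crosses no ceiling by itself; count-neutral.

## References
* [Iwaniec2002] H. Iwaniec, *Spectral Methods of Automorphic Forms*, 2nd ed., GSM 53 (2002), §7 (p. 103: the continuous spectrum; no discrete vectors in the Eisenstein integral).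
* [Borel1997] A. Borel, *Automorphic Forms on SL₂(ℝ)*, Cambridge Tracts in Math. 130 (1997), §13.
* [MoeglinWaldspurger1995] C. Mœglin, J.-L. Waldspurger, *Spectral Decomposition and Eisenstein Series* (1995), II.1.2 (Paley–Wiener ∕ holomorphy of the transforms).
* [Langlands1976] R. P. Langlands, *On the Functional Equations Satisfied by Eisenstein Series*, LNM 544 (1976), §6 (p. 167).
-/

set_option autoImplicit false
-- the mandated namespace repeats `HodgeConjecture.HodgeConjecture`, as in every `Theorems/*.lean` of this sub-problem
set_option linter.dupNamespace false

noncomputable section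

open MeasureTheory Set Filter Topology Complex Metric
open scoped ENNReal NNReal
open Literature.NumberTheory.Automorphic Literature.NumberTheory.Automorphic.UnitaryGroup AdelicGroupData
open Summit.HodgeConjecture.HodgeConjecture.Cruxes.H413.K2E1SphericalHeckeEigenSectionU2 (differentiable_integral_mul_borelHeight_cpow)
open Summit.HodgeConjecture.HodgeConjecture.Cruxes.H413.K2E1BLUniquenessU2 (tendsto_integral_mul_borelHeight_rpow_atTop)
open Summit.HodgeConjecture.HodgeConjecture.Cruxes.H413.K2E1ProjectionCommutingMultiplicationOperators (ae_eq_zero_of_ae_smul_eq_smul_of_null)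

namespace Summit.HodgeConjecture.HodgeConjecture.Cruxes.H413.K2E1SphericalTransformLevelSetsCountableU

/-! ## §1 Mathlib only: the level sets of a non-constant entire function are countable, and so are their traces on vertical lines -/

section Entire

variable {E : Type*} [NormedAddCommGroup E] [NormedSpace ℂ E]

/-- **THE LEVEL SETS OF A NON-CONSTANT ENTIRE FUNCTION ARE COUNTABLE**: for `g` analytic on a neighbourhood of `univ` and `g ≢ c`, `{z | g z = c}` is countable (identity principle ⇒
`{g ≠ c}` codiscrete in ℂ ⇒ finitely many solutions in every closed ball ⇒ countable union of finite sets). [cite: Iwaniec2002, §7 (p. 103)] -/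
theorem countable_setOf_eq_of_analyticOnNhd_univ {g : ℂ → E} (hg : AnalyticOnNhd ℂ g univ) {c : E} (hne : ∃ z, g z ≠ c) : ({z : ℂ | g z = c} : Set ℂ).Countable := by
  rcases hg.eqOn_or_eventually_ne_of_preconnected (g := fun _ => c) analyticOnNhd_const isPreconnected_univ with h | h
  · obtain ⟨z, hz⟩ := hne
    exact absurd (h (mem_univ z)) hz
  · -- `{g ≠ c}` is codiscrete within `univ`; each closed ball meets `{g = c}` in a finite set
    have hS : {z : ℂ | g z ≠ c} ∈ codiscreteWithin (univ : Set ℂ) := h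
    have hfin : ∀ n : ℕ, (closedBall (0 : ℂ) n \ {z : ℂ | g z ≠ c}).Finite := fun n =>
      (isCompact_closedBall (0 : ℂ) n).finite_sdiff_of_mem_codiscreteWithin (Filter.codiscreteWithin_mono (subset_univ _) hS)
    have hcover : ({z : ℂ | g z = c} : Set ℂ) ⊆ ⋃ n : ℕ, (closedBall (0 : ℂ) n \ {z : ℂ | g z ≠ c}) := by
      intro z hz
      obtain ⟨n, hn⟩ := exists_nat_ge ‖z‖
      refine mem_iUnion.2 ⟨n, ⟨?_, ?_⟩⟩
      · rwa [mem_closedBall, dist_zero_right]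
      · simpa only [mem_setOf_eq, not_not] using hz
    exact (countable_iUnion fun n => (hfin n).countable).mono hcover

/-- **THE LEVEL SETS OF A NON-CONSTANT ENTIRE FUNCTION ARE COUNTABLE** (`Differentiable ℂ g` edition, Mathlib `analyticOnNhd_univ_iff_differentiable`). [cite: Iwaniec2002, §7 (p. 103)] -/
theorem countable_setOf_eq_of_differentiable [CompleteSpace E] {g : ℂ → E} (hg : Differentiable ℂ g) {c : E} (hne : ∃ z, g z ≠ c) :
    ({z : ℂ | g z = c} : Set ℂ).Countable :=
  countable_setOf_eq_of_analyticOnNhd_univ (analyticOnNhd_univ_iff_differentiable.2 hg) hne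

/-- **ON A VERTICAL LINE**: for a non-constant entire `g` and any `σ : ℝ`, `{t : ℝ | g(σ + t·I) = c}` is countable (injective parametrisation `t ↦ σ + t·I` of the line `Re z = σ`).
[cite: Iwaniec2002, §7 (p. 103)] -/
theorem countable_setOf_line_eq_of_differentiable [CompleteSpace E] {g : ℂ → E} (hg : Differentiable ℂ g) {c : E} (hne : ∃ z, g z ≠ c) (σ : ℝ) :
    ({t : ℝ | g ((σ : ℂ) + (t : ℂ) * I) = c} : Set ℝ).Countable := by
  have hinj : Function.Injective fun t : ℝ => (σ : ℂ) + (t : ℂ) * I := by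
    intro t₁ t₂ h
    have h' := congrArg Complex.im h
    simpa using h'
  exact (countable_setOf_eq_of_differentiable hg hne).preimage hinj

end Entire

/-! ## §2 The spherical transform `ĥ(z) = ∫ h·H^z` is entire: countable line level sets on the letter `ĥ ≢ c` -/

section Transform

variable {F E : Type} [Field F] [NumberField F] [Field E] [NumberField E] [Algebra F E] {c : E ≃ₐ[F] E} {N : ℕ} [NeZero N]
  [MeasurableSpace (quasiSplit F E c N).Adelic] [BorelSpace (quasiSplit F E c N).Adelic]
  (μ : Measure (quasiSplit F E c N).Adelic) [IsFiniteMeasureOnCompacts μ]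

/-- **COUNTABLE LINE LEVEL SETS OF THE SPHERICAL TRANSFORM, ON THE LETTER `∃ z, ĥ z ≠ c`** (every rank): `ĥ(z) = ∫ h(x)·H(x)^z dμ` is entire (★ `differentiable_integral_mul_borelHeight_cpow`),
so `{t | ĥ(σ + t·I) = c}` is countable as soon as `ĥ ≢ c`. [cite: MoeglinWaldspurger1995, II.1.2] [cite: Langlands1976, §6 (p. 167)] [cite: Iwaniec2002, §7 (p. 103)] -/
theorem countable_setOf_sphericalTransform_line_eq_of_exists_ne {h : (quasiSplit F E c N).Adelic → ℂ} (hh : Continuous h) (hhs : HasCompactSupport h) {c₀ : ℂ}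
    (hne : ∃ z : ℂ, (∫ x, h x * (((borelHeight x : ℝ≥0) : ℝ) : ℂ) ^ z ∂μ) ≠ c₀) (σ : ℝ) :
    ({t : ℝ | (∫ x, h x * (((borelHeight x : ℝ≥0) : ℝ) : ℂ) ^ ((σ : ℂ) + (t : ℂ) * I) ∂μ) = c₀} : Set ℝ).Countable :=
  countable_setOf_line_eq_of_differentiable (differentiable_integral_mul_borelHeight_cpow μ hh hhs) hne σ

end Transform

/-! ## §3 Non-constancy, letter-free: `h ≥ 0` charging a point of height `> 1` -/

section NonConstant

variable {F E : Type} [Field F] [NumberField F] [Field E] [NumberField E] [Algebra F E] {c : E ≃ₐ[F] E} {N : ℕ} [NeZero N]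
  [MeasurableSpace (quasiSplit F E c N).Adelic] [BorelSpace (quasiSplit F E c N).Adelic]
  (μ : Measure (quasiSplit F E c N).Adelic)

omit [BorelSpace (quasiSplit F E c N).Adelic] in
/-- On the real axis the complex spherical transform of a REAL `h` is the real one: `ĥ(σ) = ↑(∫ h(x)·H(x)^σ dμ)` (`H > 0`, `Complex.ofReal_cpow`, `integral_ofReal`). [folklore] -/
theorem integral_mul_borelHeight_cpow_ofReal (h : (quasiSplit F E c N).Adelic → ℝ) (σ : ℝ) :
    (∫ x, ((h x : ℝ) : ℂ) * (((borelHeight x : ℝ≥0) : ℝ) : ℂ) ^ ((σ : ℝ) : ℂ) ∂μ) = (((∫ x, h x * ((borelHeight x : ℝ≥0) : ℝ) ^ σ ∂μ) : ℝ) : ℂ) := by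
  have hfun : (fun x : (quasiSplit F E c N).Adelic => ((h x : ℝ) : ℂ) * (((borelHeight x : ℝ≥0) : ℝ) : ℂ) ^ ((σ : ℝ) : ℂ)) =
      fun x => (((h x * ((borelHeight x : ℝ≥0) : ℝ) ^ σ : ℝ)) : ℂ) := by
    funext x
    rw [Complex.ofReal_mul, Complex.ofReal_cpow (NNReal.coe_nonneg _)]
  rw [hfun]
  exact integral_complex_ofReal

/-- **THE SPHERICAL TRANSFORM IS NOT CONSTANT** (every rank, letter-free): for `h ≥ 0` continuous of compact support with `h(g₀) ≠ 0` at some `g₀` of height `H(g₀) > 1`, and `μ` finite on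
compacta and positive on open sets (Haar), `ĥ(σ) → +∞` along the reals (★ `tendsto_integral_mul_borelHeight_rpow_atTop`), so for every `c` some `ĥ(z) ≠ c`.
[cite: BernsteinLapid2019, §4 Claim 1] [cite: MoeglinWaldspurger1995, II.1.2] -/
theorem exists_sphericalTransform_ne [IsFiniteMeasureOnCompacts μ] [μ.IsOpenPosMeasure] {h : (quasiSplit F E c N).Adelic → ℝ} (hh : Continuous h) (hhs : HasCompactSupport h)
    (h0 : ∀ x, 0 ≤ h x) {g₀ : (quasiSplit F E c N).Adelic} (hg₀ : h g₀ ≠ 0) (hH : 1 < borelHeight g₀) (c₀ : ℂ) :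
    ∃ z : ℂ, (∫ x, ((h x : ℝ) : ℂ) * (((borelHeight x : ℝ≥0) : ℝ) : ℂ) ^ z ∂μ) ≠ c₀ := by
  have ht := tendsto_integral_mul_borelHeight_rpow_atTop μ hh hhs h0 hg₀ hH
  obtain ⟨σ, hσ⟩ := (ht.eventually (eventually_gt_atTop c₀.re)).exists
  refine ⟨((σ : ℝ) : ℂ), fun heq => ?_⟩
  rw [integral_mul_borelHeight_cpow_ofReal μ h σ] at heq
  have h' := congrArg Complex.re heq
  rw [Complex.ofReal_re] at h'
  exact (lt_irrefl _) (h' ▸ hσ)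

/-- **ALL LINE LEVEL SETS OF `ĥ` ARE COUNTABLE** (every rank, letter-free under §3's hypotheses): `{t | ĥ(σ + t·I) = c}` is countable for every `σ` and `c`. [cite: Iwaniec2002, §7 (p. 103)]
[cite: MoeglinWaldspurger1995, II.1.2] -/
theorem countable_setOf_sphericalTransform_line_eq [IsFiniteMeasureOnCompacts μ] [μ.IsOpenPosMeasure] {h : (quasiSplit F E c N).Adelic → ℝ} (hh : Continuous h)
    (hhs : HasCompactSupport h) (h0 : ∀ x, 0 ≤ h x) {g₀ : (quasiSplit F E c N).Adelic} (hg₀ : h g₀ ≠ 0) (hH : 1 < borelHeight g₀) (σ : ℝ) (c₀ : ℂ) :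
    ({t : ℝ | (∫ x, ((h x : ℝ) : ℂ) * (((borelHeight x : ℝ≥0) : ℝ) : ℂ) ^ ((σ : ℂ) + (t : ℂ) * I) ∂μ) = c₀} : Set ℝ).Countable :=
  countable_setOf_sphericalTransform_line_eq_of_exists_ne μ (Complex.continuous_ofReal.comp hh) (hhs.comp_left Complex.ofReal_zero)
    (exists_sphericalTransform_ne μ hh hhs h0 hg₀ hH c₀) σ

/-- **THE LINE LEVEL SETS OF `ĥ` ARE NULL FOR EVERY DIFFUSE MEASURE ON `ℝ`** (`[NullSingletonClass ν]`, e.g. Lebesgue or `w(t)dt`). [cite: Iwaniec2002, §7 (p. 103)] [cite: Borel1997, §13] -/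
theorem measure_setOf_sphericalTransform_line_eq [IsFiniteMeasureOnCompacts μ] [μ.IsOpenPosMeasure] {h : (quasiSplit F E c N).Adelic → ℝ} (hh : Continuous h)
    (hhs : HasCompactSupport h) (h0 : ∀ x, 0 ≤ h x) {g₀ : (quasiSplit F E c N).Adelic} (hg₀ : h g₀ ≠ 0) (hH : 1 < borelHeight g₀) (σ : ℝ) (c₀ : ℂ)
    [MeasurableSpace ℝ] (ν : Measure ℝ) [NullSingletonClass ν] :
    ν {t : ℝ | (∫ x, ((h x : ℝ) : ℂ) * (((borelHeight x : ℝ≥0) : ℝ) : ℂ) ^ ((σ : ℂ) + (t : ℂ) * I) ∂μ) = c₀} = 0 :=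
  (countable_setOf_sphericalTransform_line_eq μ hh hhs h0 hg₀ hH σ c₀).measure_zero ν

end NonConstant

/-! ## §4 With ★ T6: the multiplication operator `M_{ĥ(σ + i·)}` has no eigenvectors against a diffuse measure -/

section NoEigen

variable {F E : Type} [Field F] [NumberField F] [Field E] [NumberField E] [Algebra F E] {c : E ≃ₐ[F] E} {N : ℕ} [NeZero N]
  [MeasurableSpace (quasiSplit F E c N).Adelic] [BorelSpace (quasiSplit F E c N).Adelic]
  (μ : Measure (quasiSplit F E c N).Adelic) [IsFiniteMeasureOnCompacts μ] [μ.IsOpenPosMeasure]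
  {V : Type*} [AddCommGroup V] [Module ℂ V]

/-- **`M_{ĥ(σ + i·)}` HAS NO EIGENVECTORS** (every rank; T6 ∘ T7): if `ĥ(σ + it)·f(t) = c·f(t)` for `ν`-a.e. `t` (`ν` a measure on `ℝ` without atoms, `f` valued in any complex vector space without
zero smul-divisors — e.g. `ℂ` or a Hilbert space), then `f = 0` `ν`-a.e.  Hypotheses on `h` as in §3. [cite: Iwaniec2002, §7 (p. 103)] [cite: Borel1997, §13] [cite: ReedSimonI1980, §VII.2] -/
theorem ae_eq_zero_of_ae_sphericalTransform_smul_eq_smul {h : (quasiSplit F E c N).Adelic → ℝ} (hh : Continuous h) (hhs : HasCompactSupport h) (h0 : ∀ x, 0 ≤ h x)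
    {g₀ : (quasiSplit F E c N).Adelic} (hg₀ : h g₀ ≠ 0) (hH : 1 < borelHeight g₀) (σ : ℝ) {c₀ : ℂ}
    [MeasurableSpace ℝ] {ν : Measure ℝ} [NullSingletonClass ν] {f : ℝ → V}
    (hf : ∀ᵐ t ∂ν, (∫ x, ((h x : ℝ) : ℂ) * (((borelHeight x : ℝ≥0) : ℝ) : ℂ) ^ ((σ : ℂ) + ((t : ℝ) : ℂ) * I) ∂μ) • f t = c₀ • f t) : f =ᵐ[ν] 0 :=
  ae_eq_zero_of_ae_smul_eq_smul_of_null hf (measure_setOf_sphericalTransform_line_eq μ hh hhs h0 hg₀ hH σ c₀ ν)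

end NoEigen

end Summit.HodgeConjecture.HodgeConjecture.Cruxes.H413.K2E1SphericalTransformLevelSetsCountableU

end
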